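import Summits.HodgeConjecture.HodgeConjecture.Theorems.HeckePrymWeilWeilTwelvefoldsSqrtMinus7AimedFrameLemmas
import Summits.HodgeConjecture.HodgeConjecture.Theorems.HeckePrymWeilWeilTwelvefoldsSqrtMinus7WeilMultiplicity
import Summits.HodgeConjecture.HodgeConjecture.Theorems.HeckePrymWeilWeilTwelvefoldsSqrtMinus7WeilSignature
import Summits.HodgeConjecture.HodgeConjecture.Theorems.HeckePrymWeilWeilTwelvefoldsSqrtMinus7SymmetricSegre
import Literature.AlgebraicGeometry.HodgeTheory.ComplexConjugationHolds
import Literature.AlgebraicGeometry.Motives.RationalDegreeOneModel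
import Literature.AlgebraicGeometry.Motives.AbelianVarietyProductDimProofs
import Summits.HodgeConjecture.HodgeConjecture.Theorems.HeckePrymWeilAimedDescendingProductModel
import Summits.HodgeConjecture.HodgeConjecture.Theorems.HeckePrymWeilAimedDescendingIsotropicGlueAll
import HarnessLib

/-!
# Crux `WeilTwelvefoldsSqrtMinus7` (stmt-HodgeConjecture-1261), line `amnesic-secant-sheaves-split-fourteenfolds` — stubs `stub_aimedFrameOfModel_of` (γ) and `stub_aimedFrameOfModel` (S7b'), r6

**The assembly of the aiming half of the product trick** (E. Markman, arXiv:2509.23403 §11.5 Step 2;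
B. van Geemen, LNM 1594 (1994), Lemma 5.2 (2)–(5), 5.3, 5.4 (5.4.1); C. Schoen, Compositio 114 (1998)
§10) from its three printed inputs, which are the HYPOTHESES of the theorem (the registered stubs α₁,
α₂, β of the line's skeleton, reshape r6): α₁ — the Weil multiplicities `(n, n)` of `φ_A^*` on `H^{1,0}`
from a non-zero rational `(n,n)` Weil class; α₂ — the SIGNATURE `(2n, 2n)` of the symmetric form
`v ⬝ G_A (M_A w)` of the rational degree-one model, from Hodge–Riemann in degree one; β — the
`K`-symmetric weighted Segre embedding of `A × (E × E)` with hyperplane class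
`pr_A^* h_A + s·pr_{E×E}^*(m₁ pr₁^*η₀ + m₂ pr₂^*η₀)`.

Given these, for an elliptic curve `(E, φ)`, `φ ≫ φ = -7`, with an integer model `(x, M)` of `φ^*` on
`H¹(E(ℂ); ℂ)`, and a Weil pair `(A, φ_A)` of dimension `2n ≥ 2` with a non-zero rational `(n,n)` Weil class
and Hodge–Riemann in degree one for its hyperplane classes, the product `A × (E × E)` with
`Ψ = φ_A × (φ, -φ)` carries a projective embedding `e` and a rational `a ≠ 0` whose `K`-symmetrised
hyperplane class `7·e^*a + Ψ^*e^*a` makes `(A × (E × E), Ψ)` of HYPERBOLIC Weil type in half-dimension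
`n + 1` (`Motives.IsHyperbolicWeilType`). Proof (`stub_aimedFrameOfModel_of`): a real Hodge model of `A`
(`exists_isReal_hodgeModel_holds`); β at `η₀ = x₀ ⌣ x₁` gives `(e_A, a_A, s)` with `h_A = e_A^*a_A`
`K`-symmetric; the rational model `(u, M_A, ω_A, G_A, d_A)` of `(A, φ_A, h_A)`
(`Motives.exists_rationalModel_one`) is of Weil type, alternating, `M_A² = -7`, on `4n` vectors
(`af_weilModel`, sibling file `…AimedFrameLemmas`), and α₁ + Hodge–Riemann + α₂ give its signature
`hPN`; with the binary partner `(M, !![0, 1; -1, 0], e₀)` (`af_partnerModel`) and the weights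
`κ₁ = C(2n+1, 2n-1)·C(2,1)·s²`, `κ₂ = C(2n+1, 2n)·d_A·s` (the binomial / top-intersection constants of the
block Gram matrix of `A × (E × E)`, `Theorems.polarizationPairingOne_sumElim`, `lefschetzPow_add_map_self`),
`Theorems.exists_isotropic_blockVectors'` yields `m₁, m₂ > 0` and the isotropic block vectors; β at
`(m₁, m₂)` yields `(e, a)` with `e^*a = pr_A^* h_A + pr_B^* h_B`, `h_B = pr₁^*(s m₁ η₀) + pr₂^*(s m₂ η₀)`;
the `K`-symmetrised class is `14 · e^*a` (`af_product_symm`), and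
`Motives.isHyperbolicWeilType_prod_of_rationalModels` with `isHyperbolicWeilType_smul_iff` concludes.
No named fact is taken (beyond the three hypotheses).
-/

noncomputable section

set_option linter.dupNamespace false

open CategoryTheory Complex
open Literature.AlgebraicGeometry Literature.AlgebraicGeometry.Motives
  Literature.AlgebraicGeometry.HodgeTheory Literature.AlgebraicTopology.SingularHomology
open Literature.Geometry.Kaehler

namespace Summit.HodgeConjecture.HodgeConjecture.Theorems.WeilTwelvefoldsSqrtMinus7.AmnesicSecantSheaves

/-! ## The `K`-symmetrised product class -/

/-- **The `K`-symmetrisation of the product class is multiplication by `7`**: for `K`-symmetric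
classes `φ_A^* h_A = 7 h_A`, `ψ^* h_B = 7 h_B` on the factors,
`(φ_A × ψ)^*(pr_A^* h_A + pr_B^* h_B) = 7 · (pr_A^* h_A + pr_B^* h_B)`. [cite: Markman2025SurveySecant, §11.5 Step 2] -/
theorem af_product_symm {A B : AbelianVariety ℂ} (φ : A ⟶ A) (ψ : B ⟶ B) {hA2 : complexBetti A.X 2}
    {hB2 : complexBetti B.X 2} (hA : complexBetti.map φ.hom.hom.hom 2 hA2 = (7 : ℂ) • hA2)
    (hB : complexBetti.map ψ.hom.hom.hom 2 hB2 = (7 : ℂ) • hB2) :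
    complexBetti.map (AbelianVariety.prodLift (AbelianVariety.fst A B ≫ φ) (AbelianVariety.snd A B ≫ ψ)).hom.hom.hom 2
      (complexBetti.map (AbelianVariety.fst A B).hom.hom.hom 2 hA2 +
        complexBetti.map (AbelianVariety.snd A B).hom.hom.hom 2 hB2) =
    (7 : ℂ) • (complexBetti.map (AbelianVariety.fst A B).hom.hom.hom 2 hA2 +
        complexBetti.map (AbelianVariety.snd A B).hom.hom.hom 2 hB2) := by
  rw [map_add, map_prodLift_map_fst, map_prodLift_map_snd, hA, hB]
  simp only [map_smul, smul_add]


/-! ## The assembly (stub γ) -/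

/-- **Stub γ (r6) of the line `amnesic-secant-sheaves-split-fourteenfolds` — the assembly of the
aiming half of the product trick** (Markman, arXiv:2509.23403 §11.5 Step 2; van Geemen, LNM 1594,
Lemma 5.2 (2)–(5), 5.3, 5.4; Schoen 1998 §10) from its three printed inputs, taken as hypotheses:
α₁ (Weil multiplicities `(n, n)` from a Weil class), α₂ (the signature of the rational degree-one
model from Hodge–Riemann in degree one), β (the `K`-symmetric weighted Segre embedding of
`A × (E × E)`). Proof, on the carriers: a real Hodge model `M_A` of `A`
(`exists_isReal_hodgeModel_holds`); β gives `e_A, a_A, s` with `h_A = e_A^* a_A` `K`-symmetric; α₁ and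
the Hodge–Riemann hypothesis feed α₂ on the rational model `(u, M_A, ω_A, G_A, d_A)` of `(A, φ_A, h_A)`
(`Motives.exists_rationalModel_one`), which is of Weil type and alternating with `M_A² = -7` on
`4n = b₁(A)` vectors (`af_weilModel`); the binary partner is `(M, !![0, 1; -1, 0], e₀)` (`af_partnerModel`);
`exists_isotropic_blockVectors'` with the weights `κ₁ = C(2n+1, 2n-1)·2·s²`, `κ₂ = C(2n+1, 2n)·d_A·s`
(any rationals, possibly `0`) yields `m₁, m₂` and the isotropic block vectors; β at `(m₁, m₂)` yields
`e, a` with `e^*a = pr_A^* h_A + pr_B^* h_B`, `h_B = pr₁^*(s m₁ η₀) + pr₂^*(s m₂ η₀)`, `η₀ = x₀ ⌣ x₁`; the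
`K`-symmetrised class is `14 · e^*a` (`φ_A^* h_A = 7 h_A`, `(±φ)^* η₀ = 7 η₀`), and the product frame
`Motives.isHyperbolicWeilType_prod_of_rationalModels` (with the product model of `E × E`,
`Theorems.polarizationPairingOne_sumElim`, `lefschetzPow_add_map_self`, `map_prodLift_sumElim`) and
`isHyperbolicWeilType_smul_iff` conclude. Of the registered hypotheses on `(E, φ, x, M)`, additivity of
pull-back (implied by the tree's `complexBetti_map_neg_one`) and `H² = ℂ·η₀` are not used.
[cite: Markman2025SurveySecant, §11.5 Step 2] [cite: vanGeemen1994HodgeAV, Lemma 5.2 (2)–(5), 5.3 and 5.4 (5.4.1)]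
[cite: Schoen1998HodgeWeilAddendum, §10] -/
theorem stub_aimedFrameOfModel_of :
    (∀ (n : ℕ) (A : AbelianVariety ℂ) (φ : A ⟶ A), A.dim = 2 * n → φ ≫ φ = -((7 : ℤ) • 𝟙 A) →
      (∃ c : complexBetti A.X (2 * n), c ≠ 0 ∧ IsRationalClass c ∧
      IsOfHodgeType (2 * n) A.X (2 * n) n n c ∧
      c ∈ Module.End.eigenspace (complexBetti.map (𝟙 A + φ).hom.hom.hom (2 * n)).hom
      ((1 + Complex.I * (Real.sqrt (7 : ℝ) : ℂ)) ^ (2 * n)) ⊔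
      Module.End.eigenspace (complexBetti.map (𝟙 A + φ).hom.hom.hom (2 * n)).hom
      ((1 - Complex.I * (Real.sqrt (7 : ℝ) : ℂ)) ^ (2 * n))) →
      ∀ (M : HodgeModel (2 * n) A.X), M.IsReal →
      Module.finrank ℂ ↥(Module.End.eigenspace (complexBetti.map φ.hom.hom.hom 1).hom
      (Complex.I * (Real.sqrt (7 : ℝ) : ℂ)) ⊓ (M.hodgePQ 1 1 0).comap (M.pullback 1).hom) = n ∧
      Module.finrank ℂ ↥(Module.End.eigenspace (complexBetti.map φ.hom.hom.hom 1).hom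
      (-(Complex.I * (Real.sqrt (7 : ℝ) : ℂ))) ⊓ (M.hodgePQ 1 1 0).comap (M.pullback 1).hom) = n) →
    (∀ (n : ℕ) (A : AbelianVariety ℂ) (φ : A ⟶ A), A.dim = 2 * n → φ ≫ φ = -((7 : ℤ) • 𝟙 A) →
      ∀ (M : HodgeModel (2 * n) A.X), M.IsReal →
      Module.finrank ℂ ↥(Module.End.eigenspace (complexBetti.map φ.hom.hom.hom 1).hom
      (Complex.I * (Real.sqrt (7 : ℝ) : ℂ)) ⊓ (M.hodgePQ 1 1 0).comap (M.pullback 1).hom) = n →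
      Module.finrank ℂ ↥(Module.End.eigenspace (complexBetti.map φ.hom.hom.hom 1).hom
      (-(Complex.I * (Real.sqrt (7 : ℝ) : ℂ))) ⊓ (M.hodgePQ 1 1 0).comap (M.pullback 1).hom) = n →
      ∀ (h : complexBetti A.X 2), IsRationalClass h → complexBetti.map φ.hom.hom.hom 2 h = (7 : ℂ) • h →
      (∃ ω₀ : complexBetti A.X (2 + 2 * (2 * n - 1)), IsRationalClass ω₀ ∧ ω₀ ≠ 0 ∧
      ∀ x : complexBetti A.X 1, M.pullback 1 x ∈ M.hodgePQ 1 1 0 → x ≠ 0 →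
      ∃ t : ℝ, 0 < t ∧
      Complex.I • polarizationPairingOne A.X h (2 * n - 1) x (conjClass (ComplexPoints A.X) 1 x) =
      (t : ℂ) • ω₀) →
      ∀ (ι : Type) [Fintype ι] [DecidableEq ι] (u : ι → complexBetti A.X 1),
      (∀ i, IsRationalClass (u i)) → LinearIndependent ℂ u → Submodule.span ℂ (Set.range u) = ⊤ →
      ∀ (MA : Matrix ι ι ℚ),
      (∀ i, complexBetti.map φ.hom.hom.hom 1 (u i) = ∑ j, ((MA j i : ℚ) : ℂ) • u j) →
      ∀ (ω : complexBetti A.X (2 + 2 * (2 * n - 1))) (GA : Matrix ι ι ℚ), IsRationalClass ω → ω ≠ 0 →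
      (∀ i j, polarizationPairingOne A.X h (2 * n - 1) (u i) (u j) = ((GA i j : ℚ) : ℂ) • ω) →
      ∃ P N : Submodule ℚ (ι → ℚ), (∀ v ∈ P, MA.mulVec v ∈ P) ∧ (∀ v ∈ N, MA.mulVec v ∈ N) ∧
      Module.finrank ℚ P = 2 * n ∧ Module.finrank ℚ N = 2 * n ∧ P ⊓ N = ⊥ ∧
      (∀ x ∈ P, x ≠ 0 → 0 < x ⬝ᵥ GA.mulVec (MA.mulVec x)) ∧
      (∀ x ∈ N, x ≠ 0 → x ⬝ᵥ GA.mulVec (MA.mulVec x) < 0)) →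
    (∀ (A : AbelianVariety ℂ) (φ : A ⟶ A), φ ≫ φ = -((7 : ℤ) • 𝟙 A) →
      ∀ (E : AbelianVariety ℂ), E.dim = 1 →
      ∀ (η : complexBetti E.X 2), IsRationalClass η → η ≠ 0 →
      ∃ (eA : ProjectiveEmbedding A.X) (aA : complexBetti (projectiveSpace eA.n ℂ) 2) (s : ℚ),
      IsRationalClass aA ∧ aA ≠ 0 ∧
      complexBetti.map φ.hom.hom.hom 2 (complexBetti.map eA.ι 2 aA) = (7 : ℂ) • complexBetti.map eA.ι 2 aA ∧
      ∀ (m₁ m₂ : ℕ), 0 < m₁ → 0 < m₂ →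
      ∃ (e : ProjectiveEmbedding (A.prod (E.prod E)).X) (a : complexBetti (projectiveSpace e.n ℂ) 2),
      IsRationalClass a ∧ a ≠ 0 ∧
      complexBetti.map e.ι 2 a =
      complexBetti.map (AbelianVariety.fst A (E.prod E)).hom.hom.hom 2 (complexBetti.map eA.ι 2 aA) +
      ((s : ℚ) : ℂ) • complexBetti.map (AbelianVariety.snd A (E.prod E)).hom.hom.hom 2
      (((m₁ : ℕ) : ℂ) • complexBetti.map (AbelianVariety.fst E E).hom.hom.hom 2 η +
      ((m₂ : ℕ) : ℂ) • complexBetti.map (AbelianVariety.snd E E).hom.hom.hom 2 η)) →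
    ∀ (E : AbelianVariety ℂ) (φ : E ⟶ E), E.dim = 1 → φ ≫ φ = -((7 : ℤ) • 𝟙 E) →
    ∀ (x : Fin 2 → complexBetti E.X 1) (M : Matrix (Fin 2) (Fin 2) ℤ),
      (∀ i, IsRationalClass (x i)) → LinearIndependent ℂ x → Submodule.span ℂ (Set.range x) = ⊤ →
      (∀ i, complexBetti.map φ.hom.hom.hom 1 (x i) = ∑ j, ((M j i : ℤ) : ℂ) • x j) →
      (∀ (T : AbelianVariety ℂ) (f g : T ⟶ E) (i : Fin 2),
        complexBetti.map (f + g).hom.hom.hom 1 (x i) =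
          complexBetti.map f.hom.hom.hom 1 (x i) + complexBetti.map g.hom.hom.hom 1 (x i)) →
      cupProduct (rfl : 1 + 1 = 2) (x 0) (x 1) ≠ 0 →
      (∀ c : complexBetti E.X 2, ∃ t : ℂ, c = t • cupProduct (rfl : 1 + 1 = 2) (x 0) (x 1)) →
    ∀ (n : ℕ) (A : AbelianVariety ℂ) (φA : A ⟶ A), 1 ≤ n → A.dim = 2 * n → φA ≫ φA = -((7 : ℤ) • 𝟙 A) →
      (∃ c : complexBetti A.X (2 * n), c ≠ 0 ∧ IsRationalClass c ∧
        IsOfHodgeType (2 * n) A.X (2 * n) n n c ∧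
        c ∈ Module.End.eigenspace (complexBetti.map (𝟙 A + φA).hom.hom.hom (2 * n)).hom
              ((1 + Complex.I * (Real.sqrt (7 : ℝ) : ℂ)) ^ (2 * n)) ⊔
            Module.End.eigenspace (complexBetti.map (𝟙 A + φA).hom.hom.hom (2 * n)).hom
              ((1 - Complex.I * (Real.sqrt (7 : ℝ) : ℂ)) ^ (2 * n))) →
      (∀ (eA : ProjectiveEmbedding A.X) (aA : complexBetti (projectiveSpace eA.n ℂ) 2),
          IsRationalClass aA → aA ≠ 0 → ∀ (MA : HodgeModel (2 * n) A.X), MA.IsReal →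
        ∃ ω₀ : complexBetti A.X (2 + 2 * (2 * n - 1)), IsRationalClass ω₀ ∧ ω₀ ≠ 0 ∧
          ∀ y : complexBetti A.X 1, MA.pullback 1 y ∈ MA.hodgePQ 1 1 0 → y ≠ 0 →
            ∃ t : ℝ, 0 < t ∧
              Complex.I • polarizationPairingOne A.X (complexBetti.map eA.ι 2 aA) (2 * n - 1) y
                (conjClass (ComplexPoints A.X) 1 y) = (t : ℂ) • ω₀) →
      ∃ (e : ProjectiveEmbedding (A.prod (E.prod E)).X)
        (a : complexBetti (projectiveSpace e.n ℂ) 2),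
        IsRationalClass a ∧ a ≠ 0 ∧
        IsHyperbolicWeilType (A.prod (E.prod E))
          (AbelianVariety.prodLift (AbelianVariety.fst A (E.prod E) ≫ φA)
            (AbelianVariety.snd A (E.prod E) ≫
              AbelianVariety.prodLift (AbelianVariety.fst E E ≫ φ) (AbelianVariety.snd E E ≫ (-φ))))
          (n + 1)
          ((7 : ℂ) • complexBetti.map e.ι 2 a +
            complexBetti.map (AbelianVariety.prodLift (AbelianVariety.fst A (E.prod E) ≫ φA)
              (AbelianVariety.snd A (E.prod E) ≫
                AbelianVariety.prodLift (AbelianVariety.fst E E ≫ φ)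
                  (AbelianVariety.snd E E ≫ (-φ)))).hom.hom.hom 2
              (complexBetti.map e.ι 2 a)) := by
  intro hα₁ hα₂ hβ E φ hE hφ x M hxr hxi hxs hM _hadd hω _hH2 n A φA hn hA hφA hweil hHR
  classical
  -- dimension bookkeeping
  have hA' : A.dim = (2 * n - 1) + 1 := by rw [hA]; omega
  have hE' : E.dim = 0 + 1 := hE
  have hB' : (E.prod E).dim = 1 + 1 := by rw [AbelianVariety.dim_prod, hE]
  have hN : 2 * (n + 1) = (2 * n - 1) + 1 + 2 := by omega
  -- (1) a real Hodge model of `A`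
  obtain ⟨MH, hMH⟩ := exists_isReal_hodgeModel_holds (2 * n) A.X (isSmoothProjective_of_dim_eq' hA)
  -- (2) the `K`-symmetric Segre data (β) for `η₀ = x₀ ⌣ x₁`
  obtain ⟨eA, aA, s, haA, haA0, hsym, hemb⟩ :=
    hβ A φA hφA E hE (cupProduct (rfl : 1 + 1 = 2) (x 0) (x 1)) ((hxr 0).cup _ (hxr 1)) hω
  have hhAr : IsRationalClass (complexBetti.map eA.ι 2 aA) := haA.map _
  -- (3) multiplicities (α₁), the rational model of `(A, φ_A, h_A)`, its signature (α₂)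
  obtain ⟨hmp, hmm⟩ := hα₁ n A φA hA hφA hweil MH hMH
  obtain ⟨r, u, MA, ωA, GA, dA, hur, hui, hus, hMA, hωAr, hωA0, hGA, hdA⟩ :=
    exists_rationalModel_one φA hA' (complexBetti.map eA.ι 2 aA) hhAr
  have hPN := hα₂ n A φA hA hφA MH hMH hmp hmm (complexBetti.map eA.ι 2 aA) hhAr hsym
    (hHR eA aA haA haA0 MH hMH) (Fin r) u hur hui hus MA hMA ωA GA hωAr hωA0 hGA
  -- the model is of Weil type and alternating, `M_A² = -7`, on `4n` vectors
  obtain ⟨hWA, hGAt, hMA2, hcard⟩ := af_weilModel hn hA hφA hsym hui hus hMA hωA0 hGA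
  -- (4) the binary partner `(M, !![0, 1; -1, 0], e₀)` and (5) the isotropic block vectors
  obtain ⟨hME2, hGEt, hMx, hnMx, hgram, htop, hsymE⟩ := af_partnerModel hE hφ x hxi M hM
  obtain ⟨m₁, m₂, hm₁, hm₂, b, hb, hbM, hbG⟩ := exists_isotropic_blockVectors' (d := 7) (by norm_num)
    MA hMA2 GA hGAt hWA n hcard hPN (M.map (Int.cast : ℤ → ℚ)) hME2 !![0, 1; -1, 0] hGEt
    (Pi.single 0 1) (by simp)
    ((((2 * (n + 1) - 1).choose (2 * n - 1) : ℕ) : ℚ) * (((1 + 1).choose (0 + 1) : ℕ) : ℚ) * s * s)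
    ((((2 * (n + 1) - 1).choose (2 * n - 1 + 1) : ℕ) : ℚ) * dA * s)
  -- (6) the embedding at these weights (β)
  obtain ⟨e, a, ha, ha0, he⟩ := hemb m₁ m₂ hm₁ hm₂
  refine ⟨e, a, ha, ha0, ?_⟩
  -- (7) `e^*a = pr_A^* h_A + pr_B^* h_B` and its `K`-symmetrisation `14 · e^*a`
  have he' : complexBetti.map e.ι 2 a =
      complexBetti.map (AbelianVariety.fst A (E.prod E)).hom.hom.hom 2 (complexBetti.map eA.ι 2 aA) +
        complexBetti.map (AbelianVariety.snd A (E.prod E)).hom.hom.hom 2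
          (complexBetti.map (AbelianVariety.fst E E).hom.hom.hom 2
              ((((s * m₁ : ℚ)) : ℂ) • cupProduct (rfl : 1 + 1 = 2) (x 0) (x 1)) +
            complexBetti.map (AbelianVariety.snd E E).hom.hom.hom 2
              ((((s * m₂ : ℚ)) : ℂ) • cupProduct (rfl : 1 + 1 = 2) (x 0) (x 1))) := by
    rw [he]
    congr 1
    simp only [map_add, map_smul, smul_add, smul_smul]
    push_cast
    rfl
  have hΨ := af_product_symm φA _ hsym (hsymE (((s * m₁ : ℚ)) : ℂ) (((s * m₂ : ℚ)) : ℂ))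
  rw [he', hΨ, ← add_smul, show ((7 : ℂ) + 7) = 14 by norm_num,
    isHyperbolicWeilType_smul_iff (by norm_num : (14 : ℂ) ≠ 0)]
  -- (8) the product frame from the two rational models and the block vectors
  have hGB := polarizationPairingOne_sumElim hE' hE' (m := 1) rfl x x
    ((((s * m₁ : ℚ)) : ℂ) • cupProduct (rfl : 1 + 1 = 2) (x 0) (x 1)) (cupProduct (rfl : 1 + 1 = 2) (x 0) (x 1))
    _ (hgram _) (s * m₁) (htop _)
    ((((s * m₂ : ℚ)) : ℂ) • cupProduct (rfl : 1 + 1 = 2) (x 0) (x 1)) (cupProduct (rfl : 1 + 1 = 2) (x 0) (x 1))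
    _ (hgram _) (s * m₂) (htop _)
  have hdB := lefschetzPow_add_map_self hE' hE' (m := 1) rfl
    ((((s * m₁ : ℚ)) : ℂ) • cupProduct (rfl : 1 + 1 = 2) (x 0) (x 1)) (cupProduct (rfl : 1 + 1 = 2) (x 0) (x 1))
    (s * m₁) (htop _)
    ((((s * m₂ : ℚ)) : ℂ) • cupProduct (rfl : 1 + 1 = 2) (x 0) (x 1)) (cupProduct (rfl : 1 + 1 = 2) (x 0) (x 1))
    (s * m₂) (htop _)
  refine isHyperbolicWeilType_prod_of_rationalModels φA _ hA' hB' hN u hur hui MA hMA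
    (Sum.elim (fun i => complexBetti.map (AbelianVariety.fst E E).hom.hom.hom 1 (x i))
      (fun i => complexBetti.map (AbelianVariety.snd E E).hom.hom.hom 1 (x i)))
    ?_ (linearIndependent_sumElim_map_fst_map_snd hxi hxi)
    (Matrix.fromBlocks (M.map (Int.cast : ℤ → ℚ)) 0 0 (-(M.map (Int.cast : ℤ → ℚ))))
    (map_prodLift_sumElim φ (-φ) x _ hMx x _ hnMx)
    (complexBetti.map eA.ι 2 aA) ωA GA hGA dA hdA _ _ _ hGB _ hdB b hb hbM ?_
  · rintro (i | i)
    · exact (hxr i).map _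
    · exact (hxr i).map _
  · intro k l
    refine Eq.trans (Finset.sum_congr rfl fun p _ => Finset.sum_congr rfl fun q _ => ?_) (hbG k l)
    congr 2
    rcases p with i | (j | j) <;> rcases q with i' | (j' | j') <;>
      simp only [Matrix.fromBlocks_apply₁₁, Matrix.fromBlocks_apply₁₂, Matrix.fromBlocks_apply₂₁,
        Matrix.fromBlocks_apply₂₂, Matrix.smul_apply, Matrix.zero_apply, smul_eq_mul, Nat.choose_zero_right,
        Nat.choose_self, Nat.choose_one_right, zero_add, Nat.cast_one, one_mul] <;> push_cast <;> ring


/-- **S7b' (r6) — the AIMING half of the product trick for the partner `E × E` from its degree-one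
model, GUARDED (`1 ≤ n`) and taking Hodge–Riemann in degree one for `A` (the named fact's shape) as a
hypothesis** — the registered stub `stub_aimedFrameOfModel` of the line, obtained from the assembly
`stub_aimedFrameOfModel_of` fed with the LANDED stubs α₁ (`stub_weilMultiplicity`), α₂
(`stub_weilSignatureOfModel`), β (`stub_symmetricSegreEmbedding`). For `(E, φ, x, M)` an elliptic curve with
`φ ≫ φ = -7` and an integer model of `φ^*` on `H¹`, and every Weil pair `(A, φ_A)` of dimension `2n ≥ 2`
with `φ_A ≫ φ_A = -7`, a non-zero rational `(n,n)` Weil class and Hodge–Riemann in degree one for its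
hyperplane classes, `A × (E × E)` with `φ_A × (φ, -φ)` has a projective embedding whose `K`-symmetrised
hyperplane class makes it of HYPERBOLIC Weil type in half-dimension `n + 1` (Markman §11.5 Step 2;
van Geemen 5.2 (3), 5.3, 5.4). [cite: Markman2025SurveySecant, §11.5 Step 2]
[cite: vanGeemen1994HodgeAV, Lemma 5.2 (3), 5.3 and 5.4 (5.4.1)] [cite: Schoen1998HodgeWeilAddendum, §10] -/
theorem stub_aimedFrameOfModel :
    ∀ (E : AbelianVariety ℂ) (φ : E ⟶ E), E.dim = 1 → φ ≫ φ = -((7 : ℤ) • 𝟙 E) →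
    ∀ (x : Fin 2 → complexBetti E.X 1) (M : Matrix (Fin 2) (Fin 2) ℤ),
      (∀ i, IsRationalClass (x i)) → LinearIndependent ℂ x → Submodule.span ℂ (Set.range x) = ⊤ →
      (∀ i, complexBetti.map φ.hom.hom.hom 1 (x i) = ∑ j, ((M j i : ℤ) : ℂ) • x j) →
      (∀ (T : AbelianVariety ℂ) (f g : T ⟶ E) (i : Fin 2),
        complexBetti.map (f + g).hom.hom.hom 1 (x i) =
          complexBetti.map f.hom.hom.hom 1 (x i) + complexBetti.map g.hom.hom.hom 1 (x i)) →
      cupProduct (rfl : 1 + 1 = 2) (x 0) (x 1) ≠ 0 →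
      (∀ c : complexBetti E.X 2, ∃ t : ℂ, c = t • cupProduct (rfl : 1 + 1 = 2) (x 0) (x 1)) →
    ∀ (n : ℕ) (A : AbelianVariety ℂ) (φA : A ⟶ A), 1 ≤ n → A.dim = 2 * n → φA ≫ φA = -((7 : ℤ) • 𝟙 A) →
      (∃ c : complexBetti A.X (2 * n), c ≠ 0 ∧ IsRationalClass c ∧
        IsOfHodgeType (2 * n) A.X (2 * n) n n c ∧
        c ∈ Module.End.eigenspace (complexBetti.map (𝟙 A + φA).hom.hom.hom (2 * n)).hom
              ((1 + Complex.I * (Real.sqrt (7 : ℝ) : ℂ)) ^ (2 * n)) ⊔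
            Module.End.eigenspace (complexBetti.map (𝟙 A + φA).hom.hom.hom (2 * n)).hom
              ((1 - Complex.I * (Real.sqrt (7 : ℝ) : ℂ)) ^ (2 * n))) →
      (∀ (eA : ProjectiveEmbedding A.X) (aA : complexBetti (projectiveSpace eA.n ℂ) 2),
          IsRationalClass aA → aA ≠ 0 → ∀ (MA : HodgeModel (2 * n) A.X), MA.IsReal →
        ∃ ω₀ : complexBetti A.X (2 + 2 * (2 * n - 1)), IsRationalClass ω₀ ∧ ω₀ ≠ 0 ∧
          ∀ y : complexBetti A.X 1, MA.pullback 1 y ∈ MA.hodgePQ 1 1 0 → y ≠ 0 →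
            ∃ t : ℝ, 0 < t ∧
              Complex.I • polarizationPairingOne A.X (complexBetti.map eA.ι 2 aA) (2 * n - 1) y
                (conjClass (ComplexPoints A.X) 1 y) = (t : ℂ) • ω₀) →
      ∃ (e : ProjectiveEmbedding (A.prod (E.prod E)).X)
        (a : complexBetti (projectiveSpace e.n ℂ) 2),
        IsRationalClass a ∧ a ≠ 0 ∧
        IsHyperbolicWeilType (A.prod (E.prod E))
          (AbelianVariety.prodLift (AbelianVariety.fst A (E.prod E) ≫ φA)
            (AbelianVariety.snd A (E.prod E) ≫
              AbelianVariety.prodLift (AbelianVariety.fst E E ≫ φ) (AbelianVariety.snd E E ≫ (-φ))))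
          (n + 1)
          ((7 : ℂ) • complexBetti.map e.ι 2 a +
            complexBetti.map (AbelianVariety.prodLift (AbelianVariety.fst A (E.prod E) ≫ φA)
              (AbelianVariety.snd A (E.prod E) ≫
                AbelianVariety.prodLift (AbelianVariety.fst E E ≫ φ)
                  (AbelianVariety.snd E E ≫ (-φ)))).hom.hom.hom 2
              (complexBetti.map e.ι 2 a)) :=
  stub_aimedFrameOfModel_of stub_weilMultiplicity stub_weilSignatureOfModel stub_symmetricSegreEmbedding

end Summit.HodgeConjecture.HodgeConjecture.Theorems.WeilTwelvefoldsSqrtMinus7.AmnesicSecantSheaves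

end
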